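import Summits.QuantumFields.YangMills.Theorems.LuscherReductionTwistedTraceScalingFloorTube
import Summits.QuantumFields.YangMills.Theorems.LuscherReductionTwistedTraceScalingFloorFrameDefect
import Summits.QuantumFields.YangMills.Theorems.LuscherReductionTwistedTraceScalingGaussianTail
import HarnessLib

/-!
# The constants of the k = 0 FLOOR and the trial state one chart step away (part 1 of the POINTWISE SUB-SOLUTION BOUND `(K_β ψ)(W) ≥ m·ψ(W) − r`;
# lane A of S-BASE, crux `TwistedTraceScaling` stmt-QuantumFields-20203; design note `pub/ym-fleet/ym-luscher-20007-p1/COARSE-DESIGN.md` §18)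

`ψ = floorTrial β μ γ = H·G` (`…FloorTube`).  At a near-vacuum step `W` (links in the upper hemisphere, vector parts `≤ τ ≤ 1/30`, `d_tor W ≤ τ_d`), with lane B's
chart data (`0 ≤ ρ ≤ 1/100`, `δ < 1`, `(1−δ)²(1+ρ²) ≤ 1`), the tube action level `σ(τ) = tubeSigma L τ ≤ 1/16`, and the softness window
`2(√μ + 504τ√N)² ≤ 2 − 2cos(2π/L)` (`L ≥ 2`):

  `(K_β ψ)(W) ≥ floorCK · e^{−riccatiTrialErr} · e^{−γ(2τ_d δ₁ + δ₁²)} · e^{−floorDefect} · √(π/β)^{3|E|} · e^{−6·toronZPE L (1/2) 0 0} · ψ(W) − floorCK · floorTail`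

(`floor_subsolution_near`, in `…FloorSubsolution`), where `floorCK = ((2π²)⁻¹(1+ρ²)⁻²)^{|E|} e^{2β|E|} e^{−(β/2)(stepErrUp + chartErr)(ρ, σ(τ))}` is lane B's LOWER prefactor, `riccatiTrialErr` its
trial-exponent error for the Riccati weight `riccatiWeight (β/2) β μ`, `δ₁ = chartMove L ρ = |E|√2ρ` the link displacement of a chart step, `floorTail = e^{−βρ²/2}(2π/β)^{3|E|/2}`
the Gaussian mass off the chart ball, and `floorDefect(β, μ, τ) = O(βτ⁴ + τ)` the TUBE DEFECT (potential-vs-curvature, Bianchi, soft normalisation, zero-point Lipschitz,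
soft sub-solution).  THIS FILE: §2 the constants as explicit functions (`tubeSigma`, `floorCK`, `riccatiTrialErr`, `chartMove`, `floorDefect`, `floorTail`,
`floorModel`) with their signs; §3 `lowerModel_floorTrial_ge` (the trial state one chart step away: lane B's `Cov.exp_neg_model_le_step` + the cut-off's Lipschitz bound),
`integrable_lowerModel_floorTrial`; §4 `integral_chartBall_ge` (the ball integral is the all-space Gaussian integral minus `floorTail`).  Part 2 (`…FloorSubsolution`):
the closed form bounded below and the assembly with `Cov.model_le_transferApply`.
HONEST FRAMING: fixed-lattice Gaussian bookkeeping for a stub lane of a child of the CONDITIONAL reduction route (femto rung R2b1); not infinite volume, not a gap, not Clay.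

## References
* M. Lüscher, Nucl. Phys. B219 (1983) 233, §3. [Luscher1983]
* A. Wipf, LNP 992 (2021), §8.5. [Wipf2021]
-/

set_option autoImplicit false

noncomputable section

open MeasureTheory Real Finset
open scoped BigOperators RealInnerProductSpace
open Literature.MathematicalPhysics.QuantumFieldTheory
open Literature.MathematicalPhysics.QuantumLattice

namespace Summit.QuantumFields.YangMills.Theorems.FemtoTransferGap

open TwoLattice TwoLattice.Toron TwoLattice.Cov TwoLattice.Stiff TwoLattice.Harm TwoLattice.GnChart TwoLattice.Flat

variable {L : ℕ} [NeZero L]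

/-! ## §1 Small facts -/

/-- Off the chart ball the Euclidean norm is at least `ρ` (`ρ ≥ 0`): one link already carries `Σ_a x_{e,a}² > ρ²`. [folklore] -/
theorem le_norm_of_not_mem_chartBall {ρ : ℝ} (hρ : 0 ≤ ρ) {x : LinkSpace L} (hx : x ∉ chartBall L ρ) : ρ ≤ ‖x‖ := by
  simp only [chartBall, Set.mem_setOf_eq, not_forall, not_le] at hx
  obtain ⟨e, he⟩ := hx
  have h1 : ∑ a, x (e, a) ^ 2 ≤ ‖x‖ ^ 2 := by
    rw [EuclideanSpace.norm_sq_eq]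
    have : ∑ a, x (e, a) ^ 2 = ∑ i ∈ (Finset.univ : Finset (Fin 3)).image (fun a => (e, a)), ‖x i‖ ^ 2 := by
      rw [Finset.sum_image (fun a _ b _ h => (Prod.mk.inj h).2)]
      exact Finset.sum_congr rfl fun a _ => by rw [Real.norm_eq_abs, sq_abs]
    rw [this]
    exact Finset.sum_le_sum_of_subset_of_nonneg (Finset.subset_univ _) fun i _ _ => sq_nonneg _
  nlinarith [norm_nonneg x]

omit [NeZero L] in
/-- `trialErr ≥ 0` for non-negative data. [folklore] -/
theorem trialErr_nonneg {ρ σ N n m m₁ Lg : ℝ} (hρ : 0 ≤ ρ) (hm : 0 ≤ m) (hm₁ : 0 ≤ m₁) (hL : 0 ≤ Lg) :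
    0 ≤ trialErr ρ σ N n m m₁ Lg := by
  unfold trialErr stepRem
  positivity

/-! ## §2 The constants of the floor (explicit functions of `β`, the tube radius `τ`, the chart radius `ρ`, the soft cap `μ`) -/

variable (L) in
/-- The tube action level `σ(τ) = (10τ√N)² + N_P(29376τ³ + 700569τ⁴)` (`S(W) ≤ σ(τ)` for a near-vacuum step, `…FloorTube`). [cite: Luscher1983, §3] -/
def tubeSigma (τ : ℝ) : ℝ :=
  (10 * τ * Real.sqrt (Fintype.card (Plaquette 3 L × Fin 3))) ^ 2 + (Fintype.card (Plaquette 3 L) : ℝ) * (29376 * τ ^ 3 + 700569 * τ ^ 4)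

variable (L) in
/-- Lane B's LOWER prefactor at the tube action level: `C_K = ((2π²)⁻¹(1+ρ²)⁻²)^{|E|} e^{2β|E|} e^{−(β/2)(stepErrUp + chartErr)(ρ, σ(τ))}`. [cite: Luscher1983, §3] -/
def floorCK (β ρ τ : ℝ) : ℝ :=
  ((2 * π ^ 2)⁻¹ * ((1 + ρ ^ 2)⁻¹) ^ 2) ^ Fintype.card (Edge 3 L) * Real.exp (2 * β) ^ Fintype.card (Edge 3 L) *
    Real.exp (-(β / 2) * (stepErrUp ρ (tubeSigma L τ) (Fintype.card (Plaquette 3 L × Fin 3)) +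
      chartErr ρ (tubeSigma L τ) (Fintype.card (Plaquette 3 L × Fin 3))))

variable (L) in
/-- Lane B's trial-exponent error along a chart step, for the Riccati weight `riccatiWeight (β/2) β μ` at action level `σ`:
`trialErr ρ σ N n (ĝ/μ) ĝ (3t/μ² + 3β/μ³)`, `ĝ = √(t² + 2tβ/μ)`, `t = β/2`. [cite: Luscher1983, §3] -/
def riccatiTrialErr (β μ ρ σ : ℝ) : ℝ :=
  trialErr ρ σ (Fintype.card (Plaquette 3 L × Fin 3)) (Fintype.card (Edge 3 L × Fin 3))
    (Real.sqrt ((β / 2) ^ 2 + 2 * (β / 2) * β / μ) / μ) (Real.sqrt ((β / 2) ^ 2 + 2 * (β / 2) * β / μ)) (3 * (β / 2) / μ ^ 2 + 3 * β / μ ^ 3)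

variable (L) in
/-- The link displacement of a chart step of radius `ρ`: `δ₁ = |E|·√2·ρ` (`…FloorTube.sum_fd_chartStep_le`). [folklore] -/
def chartMove (ρ : ℝ) : ℝ := Fintype.card (Edge 3 L) * (Real.sqrt 2 * ρ)

variable (L) in
/-- **The TUBE DEFECT** `𝔇(β, μ, τ) = (β/2)N_P(837τ²)² + β r₁² + n·c_s·Λ + n·√(1/4)·ε + 2a(Λ(τ√n)² + r₁²)`, `ε = 504τ√N`, `Λ = 2ε²`, `r₁ = 288τ²√N + ε·τ√n`,
`a = β + (β/2)²μ/β`, `c_s = (β/2 + ĝ)/(2β)`: potential-vs-curvature, Bianchi, soft normalisation, zero-point Lipschitz and soft sub-solution defects of the Riccati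
trial state at a near-vacuum step of size `τ` — `O(βτ⁴ + τ)`. [cite: Luscher1983, §3] -/
def floorDefect (β μ τ : ℝ) : ℝ :=
  (β / 2) * ((Fintype.card (Plaquette 3 L) : ℝ) * (837 * τ ^ 2) ^ 2) +
    β * (288 * τ ^ 2 * Real.sqrt (Fintype.card (Plaquette 3 L × Fin 3)) +
      504 * τ * Real.sqrt (Fintype.card (Plaquette 3 L × Fin 3)) * (τ * Real.sqrt (Fintype.card (Edge 3 L × Fin 3)))) ^ 2 +
    (Fintype.card (Edge 3 L) * 3 : ℕ) * (((β / 2) + Real.sqrt ((β / 2) ^ 2 + 2 * (β / 2) * β / μ)) / (2 * β) *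
      (2 * (504 * τ * Real.sqrt (Fintype.card (Plaquette 3 L × Fin 3))) ^ 2)) +
    (Fintype.card (Edge 3 L) * 3 : ℕ) * (Real.sqrt (1 / 2 / 2) * (504 * τ * Real.sqrt (Fintype.card (Plaquette 3 L × Fin 3)))) +
    2 * (2 * (β / 2) + (β / 2) ^ 2 * μ / β) *
      (2 * (504 * τ * Real.sqrt (Fintype.card (Plaquette 3 L × Fin 3))) ^ 2 * (τ * Real.sqrt (Fintype.card (Edge 3 L × Fin 3))) ^ 2 +
        (288 * τ ^ 2 * Real.sqrt (Fintype.card (Plaquette 3 L × Fin 3)) +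
          504 * τ * Real.sqrt (Fintype.card (Plaquette 3 L × Fin 3)) * (τ * Real.sqrt (Fintype.card (Edge 3 L × Fin 3)))) ^ 2)

variable (L) in
/-- The Gaussian mass off the chart ball of radius `ρ`: `T = e^{−βρ²/2}·(2π/β)^{3|E|/2}`. [folklore] -/
def floorTail (β ρ : ℝ) : ℝ := Real.exp (-(β * ρ ^ 2 / 2)) * (π / (β / 2)) ^ ((Module.finrank ℝ (LinkSpace L) : ℝ) / 2)

/-- The all-space Gaussian model integrand of the floor at `W` (kinetic constant `b = β`):
`x ↦ e^{−β‖x‖²} e^{−(β/2)‖F(W) + D_W x‖²} e^{−q_{D_W}(F(W) + D_W x)}`, `q` the Riccati weight `riccatiWeight (β/2) β μ`. [cite: Wipf2021, §8.5.2] -/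
def floorModel (β μ : ℝ) (W : GaugeConfig 3 L SU2) (x : LinkSpace L) : ℝ :=
  Real.exp (-(β * ‖x‖ ^ 2)) * Real.exp (-(β / 2 * ‖plaqCurv W + covCurl W x‖ ^ 2)) *
    Real.exp (-weightForm (riccatiWeight (β / 2) β μ) (covCurl W) (plaqCurv W + covCurl W x))

/-- `floorCK ≥ 0`. [folklore] -/
theorem floorCK_nonneg (β ρ τ : ℝ) : 0 ≤ floorCK L β ρ τ := by unfold floorCK; positivity

omit [NeZero L] in
/-- `floorTail ≥ 0` (`β > 0`). [folklore] -/
theorem floorTail_nonneg {β : ℝ} (hβ : 0 < β) (ρ : ℝ) : 0 ≤ floorTail L β ρ := by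
  unfold floorTail
  exact mul_nonneg (Real.exp_pos _).le (Real.rpow_nonneg (by positivity) _)

/-- `chartMove ≥ 0` for `ρ ≥ 0`. [folklore] -/
theorem chartMove_nonneg {ρ : ℝ} (hρ : 0 ≤ ρ) : 0 ≤ chartMove L ρ := by unfold chartMove; positivity

/-- `riccatiTrialErr ≥ 0` for `ρ ≥ 0`, `μ > 0`, `β ≥ 0`. [folklore] -/
theorem riccatiTrialErr_nonneg {β μ ρ σ : ℝ} (hμ : 0 < μ) (hρ : 0 ≤ ρ) (hβ : 0 ≤ β) : 0 ≤ riccatiTrialErr L β μ ρ σ := by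
  unfold riccatiTrialErr
  refine trialErr_nonneg hρ (div_nonneg (Real.sqrt_nonneg _) hμ.le) (Real.sqrt_nonneg _) (add_nonneg ?_ ?_)
  · exact div_nonneg (by linarith) (by positivity)
  · exact div_nonneg (by linarith) (by positivity)

/-- `0 ≤ floorModel ≤ e^{−β‖x‖²}` (`μ > 0`). [folklore] -/
theorem floorModel_nonneg_le {β μ : ℝ} (hβ : 0 ≤ β) (hμ : 0 < μ) (W : GaugeConfig 3 L SU2) (x : LinkSpace L) :
    0 ≤ floorModel β μ W x ∧ floorModel β μ W x ≤ Real.exp (-(β * ‖x‖ ^ 2)) := by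
  unfold floorModel
  refine ⟨by positivity, ?_⟩
  have h2 : Real.exp (-(β / 2 * ‖plaqCurv W + covCurl W x‖ ^ 2)) ≤ 1 := by rw [Real.exp_le_one_iff, neg_nonpos]; positivity
  have h3 : Real.exp (-weightForm (riccatiWeight (β / 2) β μ) (covCurl W) (plaqCurv W + covCurl W x)) ≤ 1 := by
    rw [Real.exp_le_one_iff, neg_nonpos]; exact weightForm_nonneg (fun s => riccatiWeight_nonneg hμ s) _ _
  calc _ ≤ Real.exp (-(β * ‖x‖ ^ 2)) * 1 * 1 :=
        mul_le_mul (mul_le_mul_of_nonneg_left h2 (Real.exp_pos _).le) h3 (Real.exp_pos _).le (by positivity)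
    _ = _ := by ring

/-- The floor's model integrand is integrable (`β > 0`, `μ > 0`): it is lane B's `modelU β 0`. [folklore] -/
theorem integrable_floorModel {β μ : ℝ} (hβ : 0 < β) (hμ : 0 < μ) (W : GaugeConfig 3 L SU2) : Integrable (floorModel β μ W) := by
  have h := integrable_modelU hβ (fun s => riccatiWeight_nonneg (t := β / 2) (b := β) hμ s) (ρ := 0) W
  refine h.congr (ae_of_all _ fun x => ?_)
  simp only [modelU, floorModel]
  norm_num

/-! ## §3 The trial state one chart step away -/

/-- ★ **The lower model integrand against `ψ` dominates the cut Gaussian model**: at any `W` with `S(W) ≤ σ ≤ 1/16`, `0 ≤ ρ ≤ 1/30`, `d_tor W ≤ τ_d`, for every `x`: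
`e^{−E}·(G(W)·e^{−γ(2τ_d δ₁ + δ₁²)})·𝟙_ball(x)·floorModel(x) ≤ lowerModel β ρ ψ W x` (`E = riccatiTrialErr`, `δ₁ = chartMove`). [cite: Luscher1983, §3] -/
theorem lowerModel_floorTrial_ge {β μ γ ρ σ τd : ℝ} (hβ : 0 < β) (hμ : 0 < μ) (hγ : 0 ≤ γ) (hρ0 : 0 ≤ ρ) (hρ : ρ ≤ 1 / 30) (hσ : σ ≤ 1 / 16)
    (W : GaugeConfig 3 L SU2) (hS : wilsonAction su2Rep W ≤ σ) (hτd : torDist W ≤ τd) (x : LinkSpace L) :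
    Real.exp (-riccatiTrialErr L β μ ρ σ) * (floorCutoff γ W * Real.exp (-(γ * (2 * τd * chartMove L ρ + chartMove L ρ ^ 2)))) *
        (chartBall L ρ).indicator (floorModel β μ W) x ≤ lowerModel β ρ (floorTrial β μ γ) W x := by
  have ht0 : (0 : ℝ) ≤ β / 2 := by positivity
  have htpos : (0 : ℝ) < β / 2 := by positivity
  have hg0 : ∀ s, 0 ≤ riccatiWeight (β / 2) β μ s := fun s => riccatiWeight_nonneg hμ s
  by_cases hx : x ∈ chartBall L ρ
  · rw [Set.indicator_of_mem hx, lowerModel, Set.indicator_of_mem hx]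
    have hy : ∀ e', ∑ a', linkCurry x e' a' ^ 2 ≤ ρ ^ 2 :=
      (chartVec_mem_chartBall_iff ρ (linkCurry x)).mp (by rw [chartVec_linkCurry]; exact hx)
    -- `H(P·W) ≥ e^{−E} e^{−q(F + Dx)}`
    have hHge : Real.exp (-riccatiTrialErr L β μ ρ σ) *
        Real.exp (-weightForm (riccatiWeight (β / 2) β μ) (covCurl W) (plaqCurv W + covCurl W x)) ≤
        stiffTrial (riccatiWeight (β / 2) β μ) (latPatternChart L (fun _ => false) (linkCurry x) * W) := by
      have h := exp_neg_model_le_step W (linkCurry x) hg0 (fun s => riccatiWeight_le hμ ht0 hβ.le s)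
        (fun s hs' => riccatiWeight_mul_le hμ ht0 hβ.le hs') (by positivity) (fun s₁ s₂ => abs_riccatiWeight_sub_le hμ htpos hβ.le s₁ s₂)
        hρ0 hρ hσ hS hy
      rw [chartVec_linkCurry] at h
      exact h
    -- `G(P·W) ≥ G(W) e^{−γ'}`
    have hGge : floorCutoff γ W * Real.exp (-(γ * (2 * τd * chartMove L ρ + chartMove L ρ ^ 2))) ≤
        floorCutoff γ (latPatternChart L (fun _ => false) (linkCurry x) * W) := by
      have hmove : ∑ e' : Edge 3 L, fd ((latPatternChart L (fun _ => false) (linkCurry x) * W) e') (W e') ≤ chartMove L ρ :=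
        sum_fd_chartStep_le W hρ0 (linkCurry x) hy
      refine le_trans ?_ (floorCutoff_step_ge hγ W _ hmove)
      refine mul_le_mul_of_nonneg_left (Real.exp_le_exp.2 (neg_le_neg (mul_le_mul_of_nonneg_left ?_ hγ))) (floorCutoff_pos γ W).le
      have h1 := chartMove_nonneg (L := L) hρ0
      have h2 := mul_le_mul_of_nonneg_right hτd h1
      linarith
    have hψge := mul_le_mul hHge hGge (mul_nonneg (floorCutoff_pos γ W).le (Real.exp_pos _).le) (stiffTrial_pos _ _).le
    unfold floorModel floorTrial
    rw [neg_mul]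
    calc Real.exp (-riccatiTrialErr L β μ ρ σ) * (floorCutoff γ W * Real.exp (-(γ * (2 * τd * chartMove L ρ + chartMove L ρ ^ 2)))) *
          (Real.exp (-(β * ‖x‖ ^ 2)) * Real.exp (-(β / 2 * ‖plaqCurv W + covCurl W x‖ ^ 2)) *
            Real.exp (-weightForm (riccatiWeight (β / 2) β μ) (covCurl W) (plaqCurv W + covCurl W x)))
        = Real.exp (-(β * ‖x‖ ^ 2)) * Real.exp (-(β / 2 * ‖plaqCurv W + covCurl W x‖ ^ 2)) *
            (Real.exp (-riccatiTrialErr L β μ ρ σ) * Real.exp (-weightForm (riccatiWeight (β / 2) β μ) (covCurl W) (plaqCurv W + covCurl W x)) *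
              (floorCutoff γ W * Real.exp (-(γ * (2 * τd * chartMove L ρ + chartMove L ρ ^ 2))))) := by ring
      _ ≤ Real.exp (-(β * ‖x‖ ^ 2)) * Real.exp (-(β / 2 * ‖plaqCurv W + covCurl W x‖ ^ 2)) *
            (stiffTrial (riccatiWeight (β / 2) β μ) (latPatternChart L (fun _ => false) (linkCurry x) * W) *
              floorCutoff γ (latPatternChart L (fun _ => false) (linkCurry x) * W)) := mul_le_mul_of_nonneg_left hψge (by positivity)
  · rw [Set.indicator_of_notMem hx, lowerModel, Set.indicator_of_notMem hx, mul_zero]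

/-- The lower model integrand against `ψ` is integrable (`0 ≤ lowerModel ≤ e^{−β‖x‖²}`). [folklore] -/
theorem integrable_lowerModel_floorTrial {β μ γ ρ : ℝ} (hβ : 0 < β) (hμ : 0 < μ) (hγ : 0 ≤ γ) (W : GaugeConfig 3 L SU2) :
    Integrable (lowerModel β ρ (floorTrial β μ γ) W) := by
  refine Integrable.mono' (integrable_rexp_neg_mul_sq_norm (V := LinkSpace L) hβ) ?_ (ae_of_all _ fun x => ?_)
  · have hm : Measurable (lowerModel β ρ (floorTrial β μ γ) W) := by
      unfold lowerModel
      refine Measurable.indicator ?_ (measurableSet_chartBall ρ)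
      have hc : Continuous fun x : LinkSpace L => ‖plaqCurv W + covCurl W x‖ ^ 2 :=
        (continuous_const.add (covCurl W).continuous_of_finiteDimensional).norm.pow 2
      refine ((by fun_prop : Measurable fun x : LinkSpace L => Real.exp (-(β * ‖x‖ ^ 2))).mul
        (continuous_exp.comp (continuous_const.mul hc)).measurable).mul ?_
      refine (measurable_floorTrial β hμ hγ).comp ?_
      exact ((measurable_latPatternChart L _).comp (chartEquiv L).symm.measurable).mul measurable_const
    exact hm.aestronglyMeasurable
  · rw [Real.norm_eq_abs, abs_of_nonneg (lowerModel_nonneg β ρ (fun V => (floorTrial_pos β μ γ V).le) W x), neg_mul]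
    unfold lowerModel
    by_cases hx : x ∈ chartBall L ρ
    · rw [Set.indicator_of_mem hx]
      have h2 : Real.exp (-(β / 2) * ‖plaqCurv W + covCurl W x‖ ^ 2) ≤ 1 := by
        rw [Real.exp_le_one_iff, neg_mul, neg_nonpos]; positivity
      have h3 : floorTrial β μ γ (latPatternChart L (fun _ => false) (linkCurry x) * W) ≤ 1 := floorTrial_le_one hμ hγ _
      have h4 : 0 ≤ floorTrial β μ γ (latPatternChart L (fun _ => false) (linkCurry x) * W) := (floorTrial_pos β μ γ _).le
      calc Real.exp (-(β * ‖x‖ ^ 2)) * Real.exp (-(β / 2) * ‖plaqCurv W + covCurl W x‖ ^ 2) *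
            floorTrial β μ γ (latPatternChart L (fun _ => false) (linkCurry x) * W)
          ≤ Real.exp (-(β * ‖x‖ ^ 2)) * 1 * 1 := mul_le_mul (mul_le_mul_of_nonneg_left h2 (Real.exp_pos _).le) h3 h4 (by positivity)
        _ = _ := by ring
    · rw [Set.indicator_of_notMem hx]; positivity

/-! ## §4 The ball integral: all space minus the Gaussian tail -/

/-- ★ For `0 ≤ f ≤ e^{−β‖x‖²}` integrable (`β > 0`, `ρ ≥ 0`): `∫ f − floorTail β ρ ≤ ∫ 𝟙_ball f` — off the chart ball `‖x‖ ≥ ρ` and `Stiff.gaussian_tail_linkSpace_le`.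
[folklore] -/
theorem integral_chartBall_ge {β ρ : ℝ} (hβ : 0 < β) (hρ0 : 0 ≤ ρ) {f : LinkSpace L → ℝ} (hf : Integrable f) (hf0 : ∀ x, 0 ≤ f x)
    (hf1 : ∀ x, f x ≤ Real.exp (-(β * ‖x‖ ^ 2))) :
    (∫ x, f x) - floorTail L β ρ ≤ ∫ x, (chartBall L ρ).indicator f x := by
  have htail : ∫ x, (chartBall L ρ)ᶜ.indicator f x ≤ floorTail L β ρ := by
    have hpt : ∀ x, (chartBall L ρ)ᶜ.indicator f x ≤ Set.indicator {x : LinkSpace L | ρ ≤ ‖x‖} (fun x => Real.exp (-β * ‖x‖ ^ 2)) x := by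
      intro x
      by_cases hx : x ∈ chartBall L ρ
      · rw [Set.indicator_of_notMem (show x ∉ (chartBall L ρ)ᶜ from fun h => h hx)]
        exact Set.indicator_nonneg (fun _ _ => (Real.exp_pos _).le) x
      · rw [Set.indicator_of_mem (show x ∈ (chartBall L ρ)ᶜ from hx),
          Set.indicator_of_mem (show x ∈ {x : LinkSpace L | ρ ≤ ‖x‖} from le_norm_of_not_mem_chartBall hρ0 hx), neg_mul]
        exact hf1 x
    unfold floorTail
    refine le_trans (integral_mono_of_nonneg (ae_of_all _ fun x => Set.indicator_nonneg (fun y _ => hf0 y) x) ?_ (ae_of_all _ hpt))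
      (gaussian_tail_linkSpace_le L hβ hρ0)
    exact (integrable_rexp_neg_mul_sq_norm (V := LinkSpace L) hβ).indicator (isClosed_le continuous_const continuous_norm).measurableSet
  have hsplit : (∫ x, (chartBall L ρ).indicator f x) + (∫ x, (chartBall L ρ)ᶜ.indicator f x) = ∫ x, f x := by
    rw [integral_indicator (measurableSet_chartBall ρ), integral_indicator (measurableSet_chartBall ρ).compl]
    exact integral_add_compl (measurableSet_chartBall ρ) hf
  linarith

end Summit.QuantumFields.YangMills.Theorems.FemtoTransferGap

end
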